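import Mathlib
import Literature.Barriers.ValiantsHypothesis.AlgebraicNaturalProofs
import Summits.ValiantsHypothesis.ValiantsHypothesis.Theorems.BarrierLeverSuccinctHittingSetsForVPDimensionCount
import HarnessLib

/-!
# Crux `BarrierLever.SuccinctHittingSetsForVP` (stmt-ValiantsHypothesis-14610), line `registered` —
stub `stub_svHit`: THE ABSTRACT HITTING LEMMA OF THE SUCCINCT SHPILKA–VOLKOVICH GENERATOR

**What is proved (unconditional; a worker-sized stub of the generator form of the sparse half, it
does NOT close the item).** Pure `MvPolynomial` algebra over `ℂ`. Let `L_μ ∈ ℂ[Z]` (`μ : ι`) be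
polynomials with an "indicator" family of points `pt ν : Z → ℂ`, i.e. `L_μ(pt ν) = [μ = ν]`, and
consider the (shifted) succinct Shpilka–Volkovich map in the fresh variables `W_j` (`j < t`) and
`Z_{j,z}` (`j < t`, `z : Z`):

  `Γ_μ(W, Z) = y_μ + Σ_{j < t} W_j · L_μ(Z_j)`.

* `stub_svHit` : if `D(y + w) ≠ 0` for some `w : ι → ℂ` supported on a set `S` of `≤ t`
  coordinates, then `D ∘ Γ ≠ 0` (`D` does not annihilate `Γ`).

**Proof.** Enumerate the support injectively, `emb : S ↪ Fin t` (`S ≃ Fin |S|` followed by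
`Fin |S| ↪ Fin t`), and specialise `Z_j := pt ν` and `W_j := w ν` when `j = emb ν`, and `W_j := 0`
off the range of `emb` (`Function.extend`). Then `Γ_μ` evaluates to
`y_μ + Σ_{ν ∈ S} w_ν [μ = ν] = y_μ + w_μ` (`SvHit.sum_specialise`), so the evaluation of `D ∘ Γ` at
this point is `D(y + w) ≠ 0` (`LowDegreeEquations.eval_comp_aeval`, landed in the sibling file
`…DimensionCount`). This is Forbes–Shpilka–Volk's argument that the Shpilka–Volkovich generator
hits every polynomial with a monomial of small support (Lemma 28), in the succinct form of
Construction 25 / Lemma 31. Axioms: `propext`, `Classical.choice`, `Quot.sound`.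

References: [ForbesShpilkaVolk2018] Construction 25, Lemma 28, Lemma 31.
-/

-- layout Summits/ValiantsHypothesis/ValiantsHypothesis forces the duplicated namespace component
set_option linter.dupNamespace false

namespace Summit.ValiantsHypothesis.ValiantsHypothesis.Theorems.BarrierLever.SuccinctHittingSetsForVP

open Literature.Barriers.ValiantsHypothesis Literature.Computability.AlgebraicComplexity MvPolynomial

namespace SvHit

/-- Evaluating one coordinate of the succinct SV map `y + Σ_j W_j · L(Z_j)` at the point
`W := a`, `Z_j := q j`: the result is `y + Σ_j a_j · L(q_j)`. [folklore] -/
theorem eval_svMap {Z : Type} {t : ℕ} (a : Fin t → ℂ) (q : Fin t → Z → ℂ) (c : ℂ)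
    (P : MvPolynomial Z ℂ) :
    eval (Sum.elim a (fun jz : Fin t × Z => q jz.1 jz.2))
        ((C c : MvPolynomial (Fin t ⊕ (Fin t × Z)) ℂ) +
          ∑ j : Fin t, X (Sum.inl j) * rename (fun z => Sum.inr (j, z)) P) =
      c + ∑ j : Fin t, a j * eval (q j) P := by
  simp only [map_add, eval_C, map_sum, map_mul, eval_X, MvPolynomial.eval_rename, Sum.elim_inl]
  rfl

/-- The specialisation sum: planting `w ν` at `W_{emb ν}` and `pt ν` at `Z_{emb ν}` (zero
elsewhere) along an injective enumeration `emb : S → Fin t` of the support of `w` turns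
`Σ_j W_j · L_μ(Z_j)` into `Σ_{ν ∈ S} w_ν [μ = ν] = w_μ`.
[cite: ForbesShpilkaVolk2018, Lemma 28 and Lemma 31] -/
theorem sum_specialise {ι : Type} [DecidableEq ι] {Z : Type} {t : ℕ} (L : ι → MvPolynomial Z ℂ)
    (pt : ι → Z → ℂ) (hind : ∀ μ ν : ι, eval (pt ν) (L μ) = if μ = ν then 1 else 0)
    (S : Finset ι) (w : ι → ℂ) (hwS : ∀ μ, μ ∉ S → w μ = 0) (emb : S → Fin t)
    (hemb : Function.Injective emb) (μ : ι) :
    ∑ j : Fin t, Function.extend emb (fun ν : S => w ν) 0 j *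
        eval (Function.extend emb (fun ν : S => pt ν) 0 j) (L μ) = w μ := by
  rw [← Finset.sum_subset (Finset.subset_univ ((Finset.univ : Finset S).map ⟨emb, hemb⟩))]
  · rw [Finset.sum_map]
    simp only [Function.Embedding.coeFn_mk, hemb.extend_apply, hind, mul_ite, mul_one, mul_zero]
    rw [Finset.sum_coe_sort S (fun ν => if μ = ν then w ν else 0), Finset.sum_ite_eq]
    by_cases hμ : μ ∈ S
    · rw [if_pos hμ]
    · rw [if_neg hμ, hwS μ hμ]
  · intro j _ hj
    have hj' : ¬ ∃ ν, emb ν = j := fun ⟨ν, hν⟩ =>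
      hj (Finset.mem_map.mpr ⟨ν, Finset.mem_univ _, hν⟩)
    rw [Function.extend_apply' _ _ _ hj', Pi.zero_apply, zero_mul]

/-- The specialisation point exists: some point of `ℂ^{W ⊔ Z}` at which every coordinate
`Γ_μ = y_μ + Σ_j W_j · L_μ(Z_j)` of the succinct SV map evaluates to `y_μ + w_μ`, for any `w`
supported on `≤ t` coordinates. [cite: ForbesShpilkaVolk2018, Lemma 28 and Lemma 31] -/
theorem exists_point {ι : Type} [DecidableEq ι] {Z : Type} {t : ℕ} (L : ι → MvPolynomial Z ℂ)
    (pt : ι → Z → ℂ) (hind : ∀ μ ν : ι, eval (pt ν) (L μ) = if μ = ν then 1 else 0)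
    (y : ι → ℂ) (S : Finset ι) (w : ι → ℂ) (hSt : S.card ≤ t) (hwS : ∀ μ, μ ∉ S → w μ = 0) :
    ∃ p : Fin t ⊕ (Fin t × Z) → ℂ, ∀ μ : ι,
      eval p ((C (y μ) : MvPolynomial (Fin t ⊕ (Fin t × Z)) ℂ) +
          ∑ j : Fin t, X (Sum.inl j) * rename (fun z => Sum.inr (j, z)) (L μ)) = y μ + w μ := by
  -- the injective enumeration `S ≃ Fin |S| ↪ Fin t` of the support
  have hemb : Function.Injective (fun ν : S => Fin.castLE hSt (S.equivFin ν)) :=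
    (Fin.castLE_injective hSt).comp S.equivFin.injective
  refine ⟨Sum.elim
      (Function.extend (fun ν : S => Fin.castLE hSt (S.equivFin ν)) (fun ν : S => w ν) 0)
      (fun jz : Fin t × Z =>
        Function.extend (fun ν : S => Fin.castLE hSt (S.equivFin ν)) (fun ν : S => pt ν) 0
          jz.1 jz.2),
    fun μ => ?_⟩
  rw [eval_svMap, sum_specialise L pt hind S w hwS _ hemb μ]

end SvHit

open SvHit

/-- **Registered stub `stub_svHit`** (crux stmt-ValiantsHypothesis-14610, line `registered`): the
abstract hitting lemma of the succinct Shpilka–Volkovich generator. If the `L_μ` have indicator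
points `pt ν` (`L_μ(pt ν) = [μ = ν]`) and `D(y + w) ≠ 0` for some `w` supported on `≤ t`
coordinates, then `D` does not annihilate `Γ_μ = y_μ + Σ_{j<t} W_j · L_μ(Z_j)`.
[cite: ForbesShpilkaVolk2018, Lemma 28 and Lemma 31] -/
theorem stub_svHit :
    ∀ (ι : Type) [DecidableEq ι] (Z : Type) (t : ℕ) (L : ι → MvPolynomial Z ℂ) (pt : ι → Z → ℂ),
      (∀ μ ν : ι, MvPolynomial.eval (pt ν) (L μ) = if μ = ν then 1 else 0) →
      ∀ (y : ι → ℂ) (D : MvPolynomial ι ℂ),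
        (∃ (S : Finset ι) (w : ι → ℂ), S.card ≤ t ∧ (∀ μ, μ ∉ S → w μ = 0) ∧
            MvPolynomial.eval (fun μ => y μ + w μ) D ≠ 0) →
        MvPolynomial.aeval (fun μ : ι => (C (y μ) : MvPolynomial (Fin t ⊕ (Fin t × Z)) ℂ) +
            ∑ j : Fin t, X (Sum.inl j) * rename (fun z => Sum.inr (j, z)) (L μ)) D ≠ 0 := by
  intro ι _ Z t L pt hind y D ⟨S, w, hSt, hwS, hne⟩ h0
  obtain ⟨p, hp⟩ := exists_point L pt hind y S w hSt hwS
  apply hne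
  rw [← funext hp, ← LowDegreeEquations.eval_comp_aeval, h0, map_zero]

end Summit.ValiantsHypothesis.ValiantsHypothesis.Theorems.BarrierLever.SuccinctHittingSetsForVP
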